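import Literature.Geometry.Lorentzian.ChainDirectLimitData
import Literature.Geometry.Manifold.DirectLimitManifoldEmbedding
import Literature.Geometry.Lorentzian.DataEmbeddingNormalSmooth
import Literature.Geometry.Lorentzian.HypersurfaceNaturality
import Literature.Geometry.Lorentzian.CurvatureNaturality
import Literature.Geometry.Lorentzian.CauchyDevelopmentRestrict
import Literature.Geometry.Lorentzian.IsometryProofs
import HarnessLib

/-!
# The union of a chain of Cauchy developments, I: the limit spacetime and its data embedding
# (Choquet-Bruhat–Geroch 1969, proof of Thm. 3, p. 333)

Second file of the union-of-a-chain construction (`ChainDirectLimitData`: the chain `c` as a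
smooth directed system `chainData c hc` along the unique embeddings `ψ_αβ`). Following
Choquet-Bruhat–Geroch, Comm. Math. Phys. 14 (1969), proof of Thm. 3, p. 333 — *"`K̃` is a
manifold … carries a Lorentz metric such that each `ψ_α : N_α → K̃` is an isometry onto its image
… `S` is embedded in `K̃` via any of the `N_α` … `K̃` is a development of `S`, and `K̃ ≥ N_α` for
each `α`"* — we equip the direct limit of a monotone re-indexing `f : J → ↥c` of the chain (any
directed preorder `J`; `SmoothDirectLimitData.comapIndex`) with

* the limit spacetime `chainSpacetime` (`DirectLimitManifold`: `C^∞` manifold, Hausdorff,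
  connected; `DirectLimitMetric`: the Lorentzian metric making the canonical maps `chainIncl j`
  isometric immersions; second countable by Geroch's theorem; `DirectLimitTimeOrientation`: the
  time orientation making them time-orientation preserving);
* the data embedding `ι̃ = incl j₀ ∘ ι_{j₀}` — independent of the piece, `chainIncl_embed`:
  *"`S` is embedded in `K̃` via any of the `N_α`"* — a smooth embedding
  (`SmoothDirectLimitData.isSmoothEmbedding_incl_comp`) with future unit normal
  `d(incl j₀) ν_{j₀}`, inducing `(h, k)` (naturality of the induced metric and of the second
  fundamental form under the isometric immersion `incl j₀`,
  `PseudoRiemannianMetric.secondFundamentalForm_comap`, the normal being smooth along `ι`,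
  `DataEmbedding.mdifferentiableAt_embed_normal`): `chainDataEmbedding`;
* `embedsInto_chainDataEmbedding` — *"`K̃ ≥ N_α` for each `α`"* (data-embedding level);
* `isVacuum_chainDataEmbedding` — the union is vacuum when the pieces are (naturality of the
  Ricci tensor, `PseudoRiemannianMetric.ricci_comap_apply`).

The re-indexing is what lets the carrier of the union land in the universe of the data (`J`
countable and cofinal, `ChainUnionDevelopment`), the chain itself living one universe up. The
Cauchy-hypersurface property and the upper-bound theorem are in `ChainUnionDevelopment`.

## References

* Y. Choquet-Bruhat, R. Geroch, Comm. Math. Phys. 14 (1969) 329–335, proof of Thm. 3, p. 333.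
  [ChoquetBruhatGeroch1969CMP]
* J. Sbierski, Ann. Henri Poincaré 17 (2016) 301–329 = arXiv:1309.7591v3, §3.3 (the analogous
  steps for the gluing of two developments). [Sbierski2016AHP]
-/

noncomputable section

open scoped Manifold ContDiff Topology
open Bundle Set Function Filter _root_.Topology Literature.Geometry.Manifold

namespace Literature.Geometry.Lorentzian

universe u w

variable {n : ℕ} {X : Type u} [TopologicalSpace X] [ChartedSpace (EuclideanSpace ℝ (Fin n)) X]
  [IsManifold (𝓡 n) ∞ X] [ConnectedSpace X] {D : InitialDataSet (𝓡 n) X}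

namespace CauchyDevelopment

attribute [local instance] chainPreorder

variable {c : Set (CauchyDevelopment D)} {J : Type w} [Preorder J]

/-! ### The limit spacetime of the re-indexed chain -/

/-- The re-indexed chain as a smooth directed system. [folklore] -/
abbrev chainDataJ (hc : IsChain EmbedsInto c) (f : J → ↥c) (hf : Monotone f) : SmoothDirectLimitData (EuclideanSpace ℝ (Fin (n + 1))) J :=
  (chainData c hc).comapIndex f hf

/-- The transition maps of `chainDataJ` are the `ψ_αβ`. [folklore] -/
@[simp] theorem chainDataJ_map_apply (hc : IsChain EmbedsInto c) (f : J → ↥c) (hf : Monotone f) {j j' : J} (h : j ≤ j') (x : (f j).1.carrier) :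
    (chainDataJ hc f hf).map j j' h x = chainMap (f j) (f j') (hf h) x := rfl

/-- The metrics of the pieces are compatible with the transition maps. [folklore] -/
theorem chainDataJ_isIsometricImmersion (hc : IsChain EmbedsInto c) (f : J → ↥c) (hf : Monotone f) (j j' : J) (h : j ≤ j') :
    (f j).1.metric.IsIsometricImmersion (f j').1.metric.toPseudoRiemannianMetric
      ((chainDataJ hc f hf).map j j' h) :=
  chainMap_isIsometricImmersion (f j) (f j') (hf h)

/-- The time orientations of the pieces are compatible with the transition maps. [folklore] -/
theorem chainDataJ_preservesTimeOrientation (hc : IsChain EmbedsInto c) (f : J → ↥c) (hf : Monotone f) (j j' : J) (h : j ≤ j') :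
    (f j).1.timeOrientation.PreservesTimeOrientation ((chainDataJ hc f hf).map j j' h)
      (f j').1.timeOrientation :=
  chainMap_preservesTimeOrientation (f j) (f j') (hf h)

variable [IsDirectedOrder J] [Nonempty J]

/-- **The limit spacetime `K̃`** of the (re-indexed) chain: the direct limit manifold with the
limit Lorentzian metric and time orientation; Hausdorff and connected from the pieces, second
countable by Geroch's theorem. [cite: ChoquetBruhatGeroch1969CMP, proof of Thm. 3 (p. 333)] -/
def chainSpacetime (hc : IsChain EmbedsInto c) (f : J → ↥c) (hf : Monotone f) : Spacetime.{max u w} (n + 1) :=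
  letI := (chainDataJ hc f hf).secondCountableTopology_limit_of_lorentzian
    (fun j ↦ (f j).1.metric) (chainDataJ_isIsometricImmersion hc f hf)
  { carrier := (chainDataJ hc f hf).Limit
    metric := (chainDataJ hc f hf).limitLorentzianMetric (fun j ↦ (f j).1.metric)
      (chainDataJ_isIsometricImmersion hc f hf)
    timeOrientation := (chainDataJ hc f hf).limitTimeOrientation (fun j ↦ (f j).1.metric)
      (chainDataJ_isIsometricImmersion hc f hf) (fun j ↦ (f j).1.timeOrientation)
      (chainDataJ_preservesTimeOrientation hc f hf) }

/-- The canonical map of the piece `j` into `K̃`. [folklore] -/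
def chainIncl (hc : IsChain EmbedsInto c) (f : J → ↥c) (hf : Monotone f) (j : J) : (f j).1.carrier → (chainSpacetime hc f hf).carrier :=
  (chainDataJ hc f hf).incl j

/-- `chainIncl` is the canonical map of the directed system. [folklore] -/
theorem chainIncl_def (hc : IsChain EmbedsInto c) (f : J → ↥c) (hf : Monotone f) (j : J) : chainIncl hc f hf j = (chainDataJ hc f hf).incl j := rfl

/-- The canonical maps are compatible with the `ψ_αβ`: `incl j' ∘ ψ = incl j`. [folklore] -/
@[simp] theorem chainIncl_chainMap (hc : IsChain EmbedsInto c) (f : J → ↥c) (hf : Monotone f) {j j' : J} (h : j ≤ j') (x : (f j).1.carrier) :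
    chainIncl hc f hf j' (chainMap (f j) (f j') (hf h) x) = chainIncl hc f hf j x :=
  (chainDataJ hc f hf).incl_map h x

/-- The canonical maps are smooth. [folklore] -/
theorem contMDiff_chainIncl (hc : IsChain EmbedsInto c) (f : J → ↥c) (hf : Monotone f) (j : J) :
    ContMDiff (𝓡 (n + 1)) (𝓡 (n + 1)) ∞ (chainIncl hc f hf j) :=
  (chainDataJ hc f hf).contMDiff_incl j

/-- The canonical maps are differentiable. [folklore] -/
theorem mdifferentiable_chainIncl (hc : IsChain EmbedsInto c) (f : J → ↥c) (hf : Monotone f) (j : J) :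
    MDifferentiable (𝓡 (n + 1)) (𝓡 (n + 1)) (chainIncl hc f hf j) :=
  (contMDiff_chainIncl hc f hf j).mdifferentiable (by simp)

/-- **The canonical maps are isometric immersions into `K̃`** ("each `ψ_α : N_α → K̃` is an
isometry onto its image"). [cite: ChoquetBruhatGeroch1969CMP, proof of Thm. 3 (p. 333)] -/
theorem isIsometricImmersion_chainIncl (hc : IsChain EmbedsInto c) (f : J → ↥c) (hf : Monotone f) (j : J) :
    (f j).1.metric.IsIsometricImmersion (chainSpacetime hc f hf).metric.toPseudoRiemannianMetric
      (chainIncl hc f hf j) :=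
  (chainDataJ hc f hf).isIsometricImmersion_incl (fun j ↦ (f j).1.metric.toPseudoRiemannianMetric)
    (chainDataJ_isIsometricImmersion hc f hf) j

/-- The isometry identity of the canonical maps, applied. [folklore] -/
theorem val_chainIncl (hc : IsChain EmbedsInto c) (f : J → ↥c) (hf : Monotone f) (j : J) (x : (f j).1.carrier) (u w : TangentSpace (𝓡 (n + 1)) x) :
    (chainSpacetime hc f hf).metric.val (chainIncl hc f hf j x)
      (mfderiv (𝓡 (n + 1)) (𝓡 (n + 1)) (chainIncl hc f hf j) x u)
      (mfderiv (𝓡 (n + 1)) (𝓡 (n + 1)) (chainIncl hc f hf j) x w) = (f j).1.metric.val x u w := by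
  have h := DFunLike.congr_fun (DFunLike.congr_fun ((isIsometricImmersion_chainIncl hc f hf j).2 x) u) w
  rw [pullbackBilin_apply] at h
  exact h

/-- The canonical maps preserve the time orientation of `K̃`. [folklore] -/
theorem preservesTimeOrientation_chainIncl (hc : IsChain EmbedsInto c) (f : J → ↥c) (hf : Monotone f) (j : J) :
    (f j).1.timeOrientation.PreservesTimeOrientation (chainIncl hc f hf j)
      (chainSpacetime hc f hf).timeOrientation :=
  (chainDataJ hc f hf).preservesTimeOrientation_incl (fun j ↦ (f j).1.metric)
    (chainDataJ_isIsometricImmersion hc f hf) (fun j ↦ (f j).1.timeOrientation)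
    (chainDataJ_preservesTimeOrientation hc f hf) j

/-- The canonical maps are open embeddings. [folklore] -/
theorem isOpenEmbedding_chainIncl (hc : IsChain EmbedsInto c) (f : J → ↥c) (hf : Monotone f) (j : J) : IsOpenEmbedding (chainIncl hc f hf j) :=
  (chainDataJ hc f hf).isOpenEmbedding_incl j

/-- The canonical maps are local diffeomorphisms. [folklore] -/
theorem isLocalDiffeomorph_chainIncl (hc : IsChain EmbedsInto c) (f : J → ↥c) (hf : Monotone f) (j : J) :
    IsLocalDiffeomorph (𝓡 (n + 1)) (𝓡 (n + 1)) ∞ (chainIncl hc f hf j) :=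
  (chainDataJ hc f hf).isLocalDiffeomorph_incl j

/-- The differentials of the canonical maps are bijective. [folklore] -/
theorem mfderiv_chainIncl_bijective (hc : IsChain EmbedsInto c) (f : J → ↥c) (hf : Monotone f) (j : J) (x : (f j).1.carrier) :
    Bijective (mfderiv (𝓡 (n + 1)) (𝓡 (n + 1)) (chainIncl hc f hf j) x) :=
  ((isLocalDiffeomorph_chainIncl hc f hf j x).mfderivToContinuousLinearEquiv (by simp)).bijective

/-- Every point of `K̃` lies in the image of some piece. [folklore] -/
theorem exists_eq_chainIncl (hc : IsChain EmbedsInto c) (f : J → ↥c) (hf : Monotone f) (z : (chainSpacetime hc f hf).carrier) :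
    ∃ j x, z = chainIncl hc f hf j x :=
  (chainDataJ hc f hf).exists_eq_incl z

/-- **"`S` is embedded in `K̃` via any of the `N_α`"**: the data embeddings of all pieces agree in
`K̃`, `incl j ∘ ι_j = incl j' ∘ ι_{j'}`. [cite: ChoquetBruhatGeroch1969CMP, proof of Thm. 3 (p. 333)] -/
theorem chainIncl_embed (hc : IsChain EmbedsInto c) (f : J → ↥c) (hf : Monotone f) (j j' : J) (x : X) :
    chainIncl hc f hf j ((f j).1.embed x) = chainIncl hc f hf j' ((f j').1.embed x) := by
  obtain ⟨k, hjk, hj'k⟩ := exists_ge_ge j j'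
  rw [← chainIncl_chainMap hc f hf hjk, ← chainIncl_chainMap hc f hf hj'k, chainMap_embed,
    chainMap_embed]

/-! ### The data embedding of the union -/

/-! For the development structure the index type is taken in `Type` (in the application: a
countable cofinal sub-chain), so that the carrier of the union lies in the universe of the data
manifold, as the structure `DataEmbedding` requires. -/

variable {K : Type} [Preorder K] [IsDirectedOrder K] [Nonempty K]


/-- The pull-back of the limit metric along `incl j` is the metric of the piece
(`PseudoRiemannianMetric.comap` along the isometric immersion `incl j`). [folklore] -/
theorem comap_chainSpacetime_metric (hc : IsChain EmbedsInto c) (f : K → ↥c) (hf : Monotone f) (j : K) :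
    (chainSpacetime hc f hf).metric.toPseudoRiemannianMetric.comap
        PseudoRiemannianMetric.contMDiff_pullbackBilin_holds (chainIncl hc f hf j)
        (contMDiff_chainIncl hc f hf j) (fun x ↦ (mfderiv_chainIncl_bijective hc f hf j x).1) rfl =
      (f j).1.metric.toPseudoRiemannianMetric :=
  PseudoRiemannianMetric.ext (funext (isIsometricImmersion_chainIncl hc f hf j).2)

/-- Chain rule for `ι̃ = incl j ∘ ι_j`. [folklore] -/
theorem mfderiv_chainIncl_comp_embed (hc : IsChain EmbedsInto c) (f : K → ↥c) (hf : Monotone f) (j : K) (x : X) (v : TangentSpace (𝓡 n) x) :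
    mfderiv (𝓡 n) (𝓡 (n + 1)) (chainIncl hc f hf j ∘ (f j).1.embed) x v =
      mfderiv (𝓡 (n + 1)) (𝓡 (n + 1)) (chainIncl hc f hf j) ((f j).1.embed x)
        (mfderiv (𝓡 n) (𝓡 (n + 1)) (f j).1.embed x v) := by
  rw [mfderiv_comp x (mdifferentiable_chainIncl hc f hf j _) ((f j).1.mdifferentiable_embed x)]
  rfl

/-- **The data embedding of the union `K̃`**: `ι̃ = incl j₀ ∘ ι_{j₀}` (a smooth embedding) with
future unit normal `d(incl j₀) ν_{j₀}`, inducing `(h, k)` — `ι̃^* g̃ = ι^* (incl^* g̃) = ι^* g = h`,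
and `K = k` by naturality of the second fundamental form under the isometric immersion `incl j₀`
(`secondFundamentalForm_comap`, the normal being smooth along `ι`,
`DataEmbedding.mdifferentiableAt_embed_normal`). [cite: ChoquetBruhatGeroch1969CMP, proof of Thm. 3 (p. 333)] -/
def chainDataEmbedding (hc : IsChain EmbedsInto c) (f : K → ↥c) (hf : Monotone f) (j₀ : K) : DataEmbedding D where
  toSpacetime := chainSpacetime hc f hf
  embed := chainIncl hc f hf j₀ ∘ (f j₀).1.embed
  isSmoothEmbedding :=
    (chainDataJ hc f hf).isSmoothEmbedding_incl_comp j₀ (f j₀).1.isSmoothEmbedding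
  normal := fun x ↦ mfderiv (𝓡 (n + 1)) (𝓡 (n + 1)) (chainIncl hc f hf j₀) ((f j₀).1.embed x)
    ((f j₀).1.normal x)
  isFutureUnitNormal := by
    refine ⟨⟨fun y v ↦ ?_, fun y ↦ ?_⟩, fun y ↦ ?_⟩
    · change (chainSpacetime hc f hf).metric.val (chainIncl hc f hf j₀ ((f j₀).1.embed y))
        (mfderiv (𝓡 (n + 1)) (𝓡 (n + 1)) (chainIncl hc f hf j₀) ((f j₀).1.embed y)
          ((f j₀).1.normal y))
        (mfderiv (𝓡 n) (𝓡 (n + 1)) (chainIncl hc f hf j₀ ∘ (f j₀).1.embed) y v) = 0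
      rw [mfderiv_chainIncl_comp_embed, val_chainIncl]
      exact (f j₀).1.isFutureUnitNormal.1.1 y v
    · change (chainSpacetime hc f hf).metric.val (chainIncl hc f hf j₀ ((f j₀).1.embed y))
        (mfderiv (𝓡 (n + 1)) (𝓡 (n + 1)) (chainIncl hc f hf j₀) ((f j₀).1.embed y)
          ((f j₀).1.normal y))
        (mfderiv (𝓡 (n + 1)) (𝓡 (n + 1)) (chainIncl hc f hf j₀) ((f j₀).1.embed y)
          ((f j₀).1.normal y)) = -1
      rw [val_chainIncl]
      exact (f j₀).1.isFutureUnitNormal.1.2 y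
    · exact (preservesTimeOrientation_chainIncl hc f hf j₀).isFutureDirected_mfderiv
        (isIsometricImmersion_chainIncl hc f hf j₀).2 ((f j₀).1.isFutureUnitNormal.2 y)
  induced_h := fun y ↦ by
    rw [pullbackBilin_comp (mdifferentiable_chainIncl hc f hf j₀) (f j₀).1.mdifferentiable_embed,
      funext (isIsometricImmersion_chainIncl hc f hf j₀).2]
    exact (f j₀).1.induced_h y
  induced_k := by
    intro inst y
    haveI hLC : (f j₀).1.metric.toPseudoRiemannianMetric.HasLeviCivita :=
      (f j₀).1.metric.toPseudoRiemannianMetric.hasLeviCivita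
    haveI hgcLC : ((chainSpacetime hc f hf).metric.toPseudoRiemannianMetric.comap
        PseudoRiemannianMetric.contMDiff_pullbackBilin_holds (chainIncl hc f hf j₀)
        (contMDiff_chainIncl hc f hf j₀) (fun x ↦ (mfderiv_chainIncl_bijective hc f hf j₀ x).1)
        rfl).HasLeviCivita :=
      PseudoRiemannianMetric.hasLeviCivita _
    have key := PseudoRiemannianMetric.secondFundamentalForm_comap
      (chainSpacetime hc f hf).metric.toPseudoRiemannianMetric
      PseudoRiemannianMetric.contMDiff_pullbackBilin_holds (Φ := chainIncl hc f hf j₀)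
      (contMDiff_chainIncl hc f hf j₀) (fun x ↦ (mfderiv_chainIncl_bijective hc f hf j₀ x).1) rfl
      (f := (f j₀).1.embed) (ν := (f j₀).1.normal) (y := y) BoundarylessManifold.isInteriorPoint
      ((f j₀).1.toDataEmbedding.mdifferentiableAt_embed_normal y)
    change (chainSpacetime hc f hf).metric.toPseudoRiemannianMetric.secondFundamentalForm (𝓡 n)
      (chainIncl hc f hf j₀ ∘ (f j₀).1.embed)
      (fun x ↦ mfderiv (𝓡 (n + 1)) (𝓡 (n + 1)) (chainIncl hc f hf j₀) ((f j₀).1.embed x)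
        ((f j₀).1.normal x)) y = D.kBilin y
    rw [← key, PseudoRiemannianMetric.secondFundamentalForm_congr_metric
      (comap_chainSpacetime_metric hc f hf j₀) hgcLC hLC]
    exact (f j₀).1.induced_k y

/-- The spacetime of the data embedding of the union is `K̃`. [folklore] -/
@[simp] theorem chainDataEmbedding_toSpacetime (hc : IsChain EmbedsInto c) (f : K → ↥c) (hf : Monotone f) (j₀ : K) :
    (chainDataEmbedding hc f hf j₀).toSpacetime = chainSpacetime hc f hf := rfl

/-- The data embedding of the union is `incl j₀ ∘ ι_{j₀}`. [folklore] -/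
@[simp] theorem chainDataEmbedding_embed (hc : IsChain EmbedsInto c) (f : K → ↥c) (hf : Monotone f) (j₀ : K) :
    (chainDataEmbedding hc f hf j₀).embed = chainIncl hc f hf j₀ ∘ (f j₀).1.embed := rfl

/-- **"`K̃ ≥ N_α` for each `α`"** at the level of data embeddings: every piece embeds into the
union, by its canonical map. [cite: ChoquetBruhatGeroch1969CMP, proof of Thm. 3 (p. 333)] -/
theorem embedsInto_chainDataEmbedding (hc : IsChain EmbedsInto c) (f : K → ↥c) (hf : Monotone f) (j₀ j : K) :
    (f j).1.toDataEmbedding.EmbedsInto (chainDataEmbedding hc f hf j₀) :=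
  ⟨chainIncl hc f hf j, contMDiff_chainIncl hc f hf j, isOpenEmbedding_chainIncl hc f hf j,
    isIsometricImmersion_chainIncl hc f hf j, preservesTimeOrientation_chainIncl hc f hf j,
    funext fun x ↦ chainIncl_embed hc f hf j j₀ x⟩

/-! ### Vacuum -/

/-- **The union is vacuum when the pieces are** (naturality of the Ricci tensor under the local
isometries `incl j`, `PseudoRiemannianMetric.ricci_comap_apply`, whose differentials are onto).
[cite: ChoquetBruhatGeroch1969CMP, proof of Thm. 3 (p. 333)] -/
theorem isVacuum_chainDataEmbedding (hc : IsChain EmbedsInto c) (f : K → ↥c) (hf : Monotone f) (j₀ : K) (hvac : ∀ j, (f j).1.toDataEmbedding.IsVacuum) :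
    (chainDataEmbedding hc f hf j₀).IsVacuum := by
  intro inst p
  haveI : (chainSpacetime hc f hf).metric.toPseudoRiemannianMetric.HasLeviCivita := inst
  obtain ⟨j, a, rfl⟩ := exists_eq_chainIncl hc f hf p
  haveI hLC : (f j).1.metric.toPseudoRiemannianMetric.HasLeviCivita :=
    (f j).1.metric.toPseudoRiemannianMetric.hasLeviCivita
  set gc := (chainSpacetime hc f hf).metric.toPseudoRiemannianMetric.comap
    PseudoRiemannianMetric.contMDiff_pullbackBilin_holds (chainIncl hc f hf j)
    (contMDiff_chainIncl hc f hf j) (fun x ↦ (mfderiv_chainIncl_bijective hc f hf j x).1) rfl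
    with hgc_def
  haveI hgcLC : gc.HasLeviCivita := gc.hasLeviCivita
  have hgc : gc = (f j).1.metric.toPseudoRiemannianMetric := comap_chainSpacetime_metric hc f hf j
  refine LinearMap.ext fun V ↦ LinearMap.ext fun W ↦ ?_
  obtain ⟨Y₀, rfl⟩ := (mfderiv_chainIncl_bijective hc f hf j a).2 V
  obtain ⟨Z₀, rfl⟩ := (mfderiv_chainIncl_bijective hc f hf j a).2 W
  have key := PseudoRiemannianMetric.ricci_comap_apply
    (chainSpacetime hc f hf).metric.toPseudoRiemannianMetric
    PseudoRiemannianMetric.contMDiff_pullbackBilin_holds (Φ := chainIncl hc f hf j)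
    (contMDiff_chainIncl hc f hf j) (fun x ↦ (mfderiv_chainIncl_bijective hc f hf j x).1) rfl a Y₀ Z₀
  change (chainSpacetime hc f hf).metric.toPseudoRiemannianMetric.ricci (chainIncl hc f hf j a)
    (mfderiv (𝓡 (n + 1)) (𝓡 (n + 1)) (chainIncl hc f hf j) a Y₀)
    (mfderiv (𝓡 (n + 1)) (𝓡 (n + 1)) (chainIncl hc f hf j) a Z₀) = 0
  rw [← key, PseudoRiemannianMetric.ricci_congr_metric hgc hgcLC hLC, hvac j a]
  rfl

end CauchyDevelopment

end Literature.Geometry.Lorentzian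

end
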